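import Mathlib

/-!
# PneNP / OverlapGapAlgebra — crux `SolvableImpliesStableSection` (stmt-PneNP-2463):
# the PURE-LITERAL peeling block (4/5) — the pure-literal section: correctness and locality

Support for crux `stmt-PneNP-2463` (`Summit.PneNP.PneNP.Theses.OverlapGapAlgebra.SolvableImpliesStableSection`):
the f-free block "bounded-round pure-literal peeling gives stable sections for `k α < 2`" (the literal
refinement of `…PeelingRule.lean`).  The objects are opaque (only their specifications are used):
* `alive : ℕ → instances → clauses → Prop` with `alive 0 = everything` (`h0`) and the pure-literal rule
  (`hstep`): alive at round `t+1` iff alive at round `t` and the COMPLEMENT of every slot's literal occurs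
  in ANOTHER clause alive at round `t` (a clause with a PURE literal is peeled);
* the section `g` (`hg`): `g Φ v = true` iff some clause `i` alive at a round `t < R` has a slot `j` that is
  pure at round `t` and carries the literal `(v, true)` — every clause peeled within `R` rounds sets one of
  its pure literals true, all other variables are `false`.

* `sissQ_alive_of_le` — `alive` is antitone in the round;
* `sissQ_peeled_satisfied`, `sissQ_card_violated_le` — CORRECTNESS: every clause peeled within `R` rounds
  is satisfied by `g Φ` (a pure positive literal is set true; a pure negative literal `(v, false)` can only
  be falsified by a pure positive `(v, true)` of ANOTHER alive clause, which purity forbids), so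
  `V_g(Φ) ≤ #{i : alive R Φ i}`;
* `sissQ_alive_transfer`, `sissQ_local` — LOCALITY: `g` is a radius-`R` local rule in the sense of
  `shwRad_hamming_le`.
Axioms `propext`, `Classical.choice`, `Quot.sound`.
-/

set_option linter.dupNamespace false -- `Summit.PneNP.PneNP.…`: summit = sub-problem (D-0017)

namespace Summit.PneNP.PneNP.Theorems

open Finset
open scoped Classical

section PureRule

variable {m k n : ℕ}

/-- `alive` is antitone in the round: alive at round `t + d` implies alive at round `t`. -/
theorem sissQ_alive_of_le (alive : ℕ → (Fin m → Fin k → Fin n × Bool) → Fin m → Prop)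
    (hstep : ∀ (t : ℕ) (Φ : Fin m → Fin k → Fin n × Bool) (i : Fin m), alive (t + 1) Φ i ↔
      (alive t Φ i ∧ ∀ j : Fin k, ∃ i' : Fin m, alive t Φ i' ∧ i' ≠ i ∧
        ∃ j' : Fin k, Φ i' j' = ((Φ i j).1, !(Φ i j).2)))
    (Φ : Fin m → Fin k → Fin n × Bool) (i : Fin m) (t : ℕ) :
    ∀ d : ℕ, alive (t + d) Φ i → alive t Φ i := by
  intro d
  induction d with
  | zero => exact id
  | succ d ih => exact fun h => ih ((hstep (t + d) Φ i).1 h).1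

/-- The last round at which a clause that does not survive `R` rounds is alive. -/
private theorem sissQ_last_alive (alive : ℕ → (Fin m → Fin k → Fin n × Bool) → Fin m → Prop)
    (Φ : Fin m → Fin k → Fin n × Bool) (i : Fin m) (hal0 : alive 0 Φ i) :
    ∀ R : ℕ, ¬ alive R Φ i → ∃ t, t < R ∧ alive t Φ i ∧ ¬ alive (t + 1) Φ i := by
  intro R
  induction R with
  | zero => exact fun h => absurd hal0 h
  | succ R ih =>
    intro hna
    by_cases hR : alive R Φ i
    · exact ⟨R, Nat.lt_succ_self R, hR, hna⟩
    · obtain ⟨t, ht, h1, h2⟩ := ih hR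
      exact ⟨t, Nat.lt_succ_of_lt ht, h1, h2⟩

/-- **Correctness: peeled clauses are satisfied.** Every clause that does not survive `R` rounds of
peeling is satisfied by the section `g Φ`. -/
theorem sissQ_peeled_satisfied (alive : ℕ → (Fin m → Fin k → Fin n × Bool) → Fin m → Prop)
    (h0 : ∀ (Φ : Fin m → Fin k → Fin n × Bool) (i : Fin m), alive 0 Φ i)
    (hstep : ∀ (t : ℕ) (Φ : Fin m → Fin k → Fin n × Bool) (i : Fin m), alive (t + 1) Φ i ↔
      (alive t Φ i ∧ ∀ j : Fin k, ∃ i' : Fin m, alive t Φ i' ∧ i' ≠ i ∧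
        ∃ j' : Fin k, Φ i' j' = ((Φ i j).1, !(Φ i j).2)))
    (R : ℕ) (g : (Fin m → Fin k → Fin n × Bool) → (Fin n → Bool))
    (hg : ∀ (Φ : Fin m → Fin k → Fin n × Bool) (v : Fin n), g Φ v = true ↔
      ∃ t, t < R ∧ ∃ i : Fin m, ∃ j : Fin k, alive t Φ i ∧
        (∀ i' : Fin m, alive t Φ i' → i' ≠ i → ∀ j' : Fin k, Φ i' j' ≠ ((Φ i j).1, !(Φ i j).2)) ∧
        Φ i j = (v, true))
    (Φ : Fin m → Fin k → Fin n × Bool) (i : Fin m) (hna : ¬ alive R Φ i) :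
    ∃ j : Fin k, g Φ (Φ i j).1 = (Φ i j).2 := by
  -- the round `t < R` at which `i` is peeled, and its private slot `j`
  obtain ⟨t, htR, hal, hnal⟩ := sissQ_last_alive alive Φ i (h0 Φ i) R hna
  have hpriv : ∃ j : Fin k, ∀ i' : Fin m, alive t Φ i' → i' ≠ i → ∀ j' : Fin k,
      Φ i' j' ≠ ((Φ i j).1, !(Φ i j).2) := by
    by_contra hcon
    push Not at hcon
    apply hnal
    rw [hstep]
    refine ⟨hal, fun j => ?_⟩
    obtain ⟨i', h1, h2, j', h3⟩ := hcon j
    exact ⟨i', h1, h2, j', h3⟩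
  obtain ⟨j, hj⟩ := hpriv
  -- antitonicity
  have hmono : ∀ (t₁ t₂ : ℕ) (a : Fin m), t₁ ≤ t₂ → alive t₂ Φ a → alive t₁ Φ a := by
    intro t₁ t₂ a h12 h
    obtain ⟨d, rfl⟩ := Nat.exists_eq_add_of_le h12
    exact sissQ_alive_of_le alive hstep Φ a t₁ d h
  -- case analysis on the sign of the private literal and on `g` there
  cases hb : (Φ i j).2
  · -- negative literal `(v, false)`
    cases hgv : g Φ (Φ i j).1
    · exact ⟨j, by rw [hgv, hb]⟩
    · -- `g` sets `v := true` because of a pure positive literal `(v, true)` of some `(t', i', j')`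
      obtain ⟨t', ht'R, i', j', hal', hpriv', heq'⟩ := (hg Φ (Φ i j).1).1 hgv
      by_cases hii : i' = i
      · subst hii
        refine ⟨j', ?_⟩
        have h1 : (Φ i' j').1 = (Φ i' j).1 := by rw [heq']
        have h2 : (Φ i' j').2 = true := by rw [heq']
        rw [h1, hgv, h2]
      · exfalso
        have hlit : Φ i j = ((Φ i' j').1, !(Φ i' j').2) := by
          rw [heq']
          ext
          · rfl
          · exact hb
        have hlit' : Φ i' j' = ((Φ i j).1, !(Φ i j).2) := by rw [heq', hb]; rfl
        rcases le_or_gt t' t with htt | htt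
        · -- `i` is alive at round `t'` and carries the complement: contradicts purity of `(i', j')`
          exact hpriv' i (hmono t' t i htt hal) (Ne.symm hii) j hlit
        · -- `i'` is alive at round `t` and carries the complement: contradicts purity of `(i, j)`
          exact hj i' (hmono t t' i' htt.le hal') hii j' hlit'
  · -- positive literal `(v, true)`: `g` sets `v := true` by `(t, i, j)` itself
    refine ⟨j, ?_⟩
    rw [hb, hg]
    refine ⟨t, htR, i, j, hal, hj, ?_⟩
    ext
    · rfl
    · exact hb

/-- **Correctness, counting form.** The clauses violated by the section `g Φ` are among the clauses
alive after `R` rounds: `V_g(Φ) ≤ #{i : alive R Φ i}`. -/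
theorem sissQ_card_violated_le (alive : ℕ → (Fin m → Fin k → Fin n × Bool) → Fin m → Prop)
    (h0 : ∀ (Φ : Fin m → Fin k → Fin n × Bool) (i : Fin m), alive 0 Φ i)
    (hstep : ∀ (t : ℕ) (Φ : Fin m → Fin k → Fin n × Bool) (i : Fin m), alive (t + 1) Φ i ↔
      (alive t Φ i ∧ ∀ j : Fin k, ∃ i' : Fin m, alive t Φ i' ∧ i' ≠ i ∧
        ∃ j' : Fin k, Φ i' j' = ((Φ i j).1, !(Φ i j).2)))
    (R : ℕ) (g : (Fin m → Fin k → Fin n × Bool) → (Fin n → Bool))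
    (hg : ∀ (Φ : Fin m → Fin k → Fin n × Bool) (v : Fin n), g Φ v = true ↔
      ∃ t, t < R ∧ ∃ i : Fin m, ∃ j : Fin k, alive t Φ i ∧
        (∀ i' : Fin m, alive t Φ i' → i' ≠ i → ∀ j' : Fin k, Φ i' j' ≠ ((Φ i j).1, !(Φ i j).2)) ∧
        Φ i j = (v, true))
    (Φ : Fin m → Fin k → Fin n × Bool) :
    ((univ : Finset (Fin m)).filter fun i => ∀ j, g Φ (Φ i j).1 ≠ (Φ i j).2).card
      ≤ ((univ : Finset (Fin m)).filter fun i => alive R Φ i).card := by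
  refine Finset.card_le_card fun i hi => ?_
  rw [Finset.mem_filter] at hi ⊢
  refine ⟨mem_univ _, ?_⟩
  by_contra hna
  obtain ⟨j, hj⟩ := sissQ_peeled_satisfied alive h0 hstep R g hg Φ i hna
  exact hi.2 j hj

/-- A co-occurrence walk of length `q ≤ r` from `v` to a variable of clause `i` shows that `v` sees `i`
within radius `r` (pad with stutter steps). -/
private theorem sissQ_sees_of_reach (Φ : Fin m → Fin k → Fin n × Bool) (v : Fin n) (i : Fin m)
    (j : Fin k) (q r : ℕ) (hqr : q ≤ r) (p : ℕ → Fin n) (hp0 : p 0 = v) (hpq : p q = (Φ i j).1)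
    (hstep : ∀ s, s < q → (p s = p (s + 1) ∨
      ∃ i' : Fin m, ∃ j₁ j₂ : Fin k, (Φ i' j₁).1 = p s ∧ (Φ i' j₂).1 = p (s + 1))) :
    ∃ j : Fin k, ∃ p : ℕ → Fin n, p 0 = v ∧ p r = (Φ i j).1 ∧ ∀ s, s < r → (p s = p (s + 1) ∨
      ∃ i' : Fin m, ∃ j₁ j₂ : Fin k, (Φ i' j₁).1 = p s ∧ (Φ i' j₂).1 = p (s + 1)) := by
  refine ⟨j, fun s => p (min s q), by dsimp only; rw [Nat.zero_min, hp0],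
    by dsimp only; rw [min_eq_right hqr, hpq], ?_⟩
  intro s _
  dsimp only
  rcases Nat.lt_or_ge s q with hsq | hsq
  · rw [min_eq_left hsq.le, min_eq_left (Nat.succ_le_of_lt hsq)]
    exact hstep s hsq
  · left
    rw [min_eq_right hsq, min_eq_right (Nat.le_succ_of_le hsq)]

/-- **Locality, one direction.** If `Φ` and `Φ'` agree on every clause that `v` sees within radius `R`
(in either instance), then for every clause `i` reached from `v` by a co-occurrence walk of length `q`
in `Φ` and every round `t` with `q + t ≤ R`: alive at round `t` in `Φ` implies alive at round `t` in
`Φ'`. -/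
theorem sissQ_alive_transfer (alive : ℕ → (Fin m → Fin k → Fin n × Bool) → Fin m → Prop)
    (h0 : ∀ (Φ : Fin m → Fin k → Fin n × Bool) (i : Fin m), alive 0 Φ i)
    (hstep : ∀ (t : ℕ) (Φ : Fin m → Fin k → Fin n × Bool) (i : Fin m), alive (t + 1) Φ i ↔
      (alive t Φ i ∧ ∀ j : Fin k, ∃ i' : Fin m, alive t Φ i' ∧ i' ≠ i ∧
        ∃ j' : Fin k, Φ i' j' = ((Φ i j).1, !(Φ i j).2)))
    (R : ℕ) (Φ Φ' : Fin m → Fin k → Fin n × Bool) (v : Fin n)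
    (H : ∀ i : Fin m,
      ((∃ j : Fin k, ∃ p : ℕ → Fin n, p 0 = v ∧ p R = (Φ i j).1 ∧ ∀ s, s < R → (p s = p (s + 1) ∨
          ∃ i' : Fin m, ∃ j₁ j₂ : Fin k, (Φ i' j₁).1 = p s ∧ (Φ i' j₂).1 = p (s + 1))) ∨
       (∃ j : Fin k, ∃ p : ℕ → Fin n, p 0 = v ∧ p R = (Φ' i j).1 ∧ ∀ s, s < R → (p s = p (s + 1) ∨
          ∃ i' : Fin m, ∃ j₁ j₂ : Fin k, (Φ' i' j₁).1 = p s ∧ (Φ' i' j₂).1 = p (s + 1)))) →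
      Φ i = Φ' i) :
    ∀ (t : ℕ) (i : Fin m) (q : ℕ), q + t ≤ R →
      (∃ j : Fin k, ∃ p : ℕ → Fin n, p 0 = v ∧ p q = (Φ i j).1 ∧ ∀ s, s < q → (p s = p (s + 1) ∨
          ∃ i' : Fin m, ∃ j₁ j₂ : Fin k, (Φ i' j₁).1 = p s ∧ (Φ i' j₂).1 = p (s + 1))) →
      alive t Φ i → alive t Φ' i := by
  intro t
  induction t with
  | zero => exact fun i _ _ _ _ => h0 Φ' i
  | succ t ih =>
    intro i q hqt hreach hal
    obtain ⟨j₁, p, hp0, hpq, hpath⟩ := hreach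
    -- `Φ` and `Φ'` agree on clause `i`
    have hi : Φ i = Φ' i :=
      H i (Or.inl (sissQ_sees_of_reach Φ v i j₁ q R (by omega) p hp0 hpq hpath))
    rw [hstep] at hal
    rw [hstep]
    refine ⟨ih i q (by omega) ⟨j₁, p, hp0, hpq, hpath⟩ hal.1, fun j => ?_⟩
    obtain ⟨i', hal', hne, j', hvar⟩ := hal.2 j
    -- `i'` is reached by a walk of length `q + 1` (one more step inside clause `i`)
    have hreach' : ∃ j₂ : Fin k, ∃ p' : ℕ → Fin n, p' 0 = v ∧ p' (q + 1) = (Φ i' j₂).1 ∧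
        ∀ s, s < q + 1 → (p' s = p' (s + 1) ∨
          ∃ i'' : Fin m, ∃ j₃ j₄ : Fin k, (Φ i'' j₃).1 = p' s ∧ (Φ i'' j₄).1 = p' (s + 1)) := by
      refine ⟨j', fun s => if s ≤ q then p s else (Φ i j).1,
        by dsimp only; rw [if_pos (Nat.zero_le q), hp0],
        by dsimp only; rw [if_neg (by omega), hvar], ?_⟩
      intro s hs
      dsimp only
      rcases Nat.lt_or_ge s q with hsq | hsq
      · rw [if_pos hsq.le, if_pos (Nat.succ_le_of_lt hsq)]
        exact hpath s hsq
      · have hs' : s = q := by omega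
        subst hs'
        right
        refine ⟨i, j₁, j, ?_, ?_⟩
        · rw [if_pos le_rfl, hpq]
        · rw [if_neg (by omega)]
    have hi' : Φ i' = Φ' i' := by
      obtain ⟨j₂, p', hp'0, hp'q, hp'path⟩ := hreach'
      exact H i' (Or.inl (sissQ_sees_of_reach Φ v i' j₂ (q + 1) R (by omega) p' hp'0 hp'q hp'path))
    refine ⟨i', ih i' (q + 1) (by omega) hreach' hal', hne, j', ?_⟩
    rw [← hi', ← hi]
    exact hvar

/-- The literal set at `v := true` transfers from `Φ` to `Φ'` under the agreement hypothesis. -/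
private theorem sissQ_true_transfer (alive : ℕ → (Fin m → Fin k → Fin n × Bool) → Fin m → Prop)
    (h0 : ∀ (Φ : Fin m → Fin k → Fin n × Bool) (i : Fin m), alive 0 Φ i)
    (hstep : ∀ (t : ℕ) (Φ : Fin m → Fin k → Fin n × Bool) (i : Fin m), alive (t + 1) Φ i ↔
      (alive t Φ i ∧ ∀ j : Fin k, ∃ i' : Fin m, alive t Φ i' ∧ i' ≠ i ∧
        ∃ j' : Fin k, Φ i' j' = ((Φ i j).1, !(Φ i j).2)))
    (R : ℕ) (g : (Fin m → Fin k → Fin n × Bool) → (Fin n → Bool))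
    (hg : ∀ (Φ : Fin m → Fin k → Fin n × Bool) (v : Fin n), g Φ v = true ↔
      ∃ t, t < R ∧ ∃ i : Fin m, ∃ j : Fin k, alive t Φ i ∧
        (∀ i' : Fin m, alive t Φ i' → i' ≠ i → ∀ j' : Fin k, Φ i' j' ≠ ((Φ i j).1, !(Φ i j).2)) ∧
        Φ i j = (v, true))
    (Φ Φ' : Fin m → Fin k → Fin n × Bool) (v : Fin n)
    (H : ∀ i : Fin m,
      ((∃ j : Fin k, ∃ p : ℕ → Fin n, p 0 = v ∧ p R = (Φ i j).1 ∧ ∀ s, s < R → (p s = p (s + 1) ∨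
          ∃ i' : Fin m, ∃ j₁ j₂ : Fin k, (Φ i' j₁).1 = p s ∧ (Φ i' j₂).1 = p (s + 1))) ∨
       (∃ j : Fin k, ∃ p : ℕ → Fin n, p 0 = v ∧ p R = (Φ' i j).1 ∧ ∀ s, s < R → (p s = p (s + 1) ∨
          ∃ i' : Fin m, ∃ j₁ j₂ : Fin k, (Φ' i' j₁).1 = p s ∧ (Φ' i' j₂).1 = p (s + 1)))) →
      Φ i = Φ' i)
    (hgv : g Φ v = true) : g Φ' v = true := by
  -- the symmetric agreement hypothesis
  have H' : ∀ i : Fin m,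
      ((∃ j : Fin k, ∃ p : ℕ → Fin n, p 0 = v ∧ p R = (Φ' i j).1 ∧ ∀ s, s < R → (p s = p (s + 1) ∨
          ∃ i' : Fin m, ∃ j₁ j₂ : Fin k, (Φ' i' j₁).1 = p s ∧ (Φ' i' j₂).1 = p (s + 1))) ∨
       (∃ j : Fin k, ∃ p : ℕ → Fin n, p 0 = v ∧ p R = (Φ i j).1 ∧ ∀ s, s < R → (p s = p (s + 1) ∨
          ∃ i' : Fin m, ∃ j₁ j₂ : Fin k, (Φ i' j₁).1 = p s ∧ (Φ i' j₂).1 = p (s + 1)))) →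
      Φ' i = Φ i := fun i h => (H i h.symm).symm
  -- a clause containing `v` is seen within any radius (constant walk), in either instance
  have hconst : ∀ (Ψ : Fin m → Fin k → Fin n × Bool) (a : Fin m) (b : Fin k), (Ψ a b).1 = v →
      ∃ j : Fin k, ∃ p : ℕ → Fin n, p 0 = v ∧ p R = (Ψ a j).1 ∧ ∀ s, s < R → (p s = p (s + 1) ∨
        ∃ i' : Fin m, ∃ j₁ j₂ : Fin k, (Ψ i' j₁).1 = p s ∧ (Ψ i' j₂).1 = p (s + 1)) :=
    fun Ψ a b hab => ⟨b, fun _ => v, rfl, hab.symm, fun s _ => Or.inl rfl⟩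
  have hconst0 : ∀ (Ψ : Fin m → Fin k → Fin n × Bool) (a : Fin m) (b : Fin k), (Ψ a b).1 = v →
      ∃ j : Fin k, ∃ p : ℕ → Fin n, p 0 = v ∧ p 0 = (Ψ a j).1 ∧ ∀ s, s < 0 → (p s = p (s + 1) ∨
        ∃ i' : Fin m, ∃ j₁ j₂ : Fin k, (Ψ i' j₁).1 = p s ∧ (Ψ i' j₂).1 = p (s + 1)) :=
    fun Ψ a b hab => ⟨b, fun _ => v, rfl, hab.symm, fun s hs => absurd hs (Nat.not_lt_zero s)⟩
  obtain ⟨t, htR, i, j, hal, hpriv, heq⟩ := (hg Φ v).1 hgv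
  have hvi : (Φ i j).1 = v := by rw [heq]
  have hi : Φ i = Φ' i := H i (Or.inl (hconst Φ i j hvi))
  rw [hg]
  refine ⟨t, htR, i, j, ?_, ?_, by rw [← hi, heq]⟩
  · exact sissQ_alive_transfer alive h0 hstep R Φ Φ' v H t i 0 (by omega) (hconst0 Φ i j hvi) hal
  · intro i'' hal'' hne j'' hv''
    -- `i''` contains `v` in `Φ'`, hence agrees and is alive at round `t` in `Φ` too: contradiction
    have hv''v : (Φ' i'' j'').1 = v := by rw [hv'', ← hi, ← hvi]
    have hi'' : Φ' i'' = Φ i'' := H' i'' (Or.inl (hconst Φ' i'' j'' hv''v))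
    have hal''Φ : alive t Φ i'' :=
      sissQ_alive_transfer alive h0 hstep R Φ' Φ v H' t i'' 0 (by omega) (hconst0 Φ' i'' j'' hv''v) hal''
    refine hpriv i'' hal''Φ hne j'' ?_
    rw [← hi'', hv'', ← hi]

/-- **Locality: the peeling section is a radius-`R` local rule.** If `Φ` and `Φ'` agree on every clause
that `v` sees within radius `R` (hypothesis shape `hloc` of `shwRad_hamming_le`), then
`g Φ v = g Φ' v`. -/
theorem sissQ_local (alive : ℕ → (Fin m → Fin k → Fin n × Bool) → Fin m → Prop)
    (h0 : ∀ (Φ : Fin m → Fin k → Fin n × Bool) (i : Fin m), alive 0 Φ i)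
    (hstep : ∀ (t : ℕ) (Φ : Fin m → Fin k → Fin n × Bool) (i : Fin m), alive (t + 1) Φ i ↔
      (alive t Φ i ∧ ∀ j : Fin k, ∃ i' : Fin m, alive t Φ i' ∧ i' ≠ i ∧
        ∃ j' : Fin k, Φ i' j' = ((Φ i j).1, !(Φ i j).2)))
    (R : ℕ) (g : (Fin m → Fin k → Fin n × Bool) → (Fin n → Bool))
    (hg : ∀ (Φ : Fin m → Fin k → Fin n × Bool) (v : Fin n), g Φ v = true ↔
      ∃ t, t < R ∧ ∃ i : Fin m, ∃ j : Fin k, alive t Φ i ∧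
        (∀ i' : Fin m, alive t Φ i' → i' ≠ i → ∀ j' : Fin k, Φ i' j' ≠ ((Φ i j).1, !(Φ i j).2)) ∧
        Φ i j = (v, true))
    (Φ Φ' : Fin m → Fin k → Fin n × Bool) (v : Fin n)
    (H : ∀ i : Fin m,
      ((∃ j : Fin k, ∃ p : ℕ → Fin n, p 0 = v ∧ p R = (Φ i j).1 ∧ ∀ s, s < R → (p s = p (s + 1) ∨
          ∃ i' : Fin m, ∃ j₁ j₂ : Fin k, (Φ i' j₁).1 = p s ∧ (Φ i' j₂).1 = p (s + 1))) ∨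
       (∃ j : Fin k, ∃ p : ℕ → Fin n, p 0 = v ∧ p R = (Φ' i j).1 ∧ ∀ s, s < R → (p s = p (s + 1) ∨
          ∃ i' : Fin m, ∃ j₁ j₂ : Fin k, (Φ' i' j₁).1 = p s ∧ (Φ' i' j₂).1 = p (s + 1)))) →
      Φ i = Φ' i) :
    g Φ v = g Φ' v := by
  have H' : ∀ i : Fin m,
      ((∃ j : Fin k, ∃ p : ℕ → Fin n, p 0 = v ∧ p R = (Φ' i j).1 ∧ ∀ s, s < R → (p s = p (s + 1) ∨
          ∃ i' : Fin m, ∃ j₁ j₂ : Fin k, (Φ' i' j₁).1 = p s ∧ (Φ' i' j₂).1 = p (s + 1))) ∨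
       (∃ j : Fin k, ∃ p : ℕ → Fin n, p 0 = v ∧ p R = (Φ i j).1 ∧ ∀ s, s < R → (p s = p (s + 1) ∨
          ∃ i' : Fin m, ∃ j₁ j₂ : Fin k, (Φ i' j₁).1 = p s ∧ (Φ i' j₂).1 = p (s + 1)))) →
      Φ' i = Φ i := fun i h => (H i h.symm).symm
  rw [Bool.eq_iff_iff]
  exact ⟨sissQ_true_transfer alive h0 hstep R g hg Φ Φ' v H,
    sissQ_true_transfer alive h0 hstep R g hg Φ' Φ v H'⟩

end PureRule

end Summit.PneNP.PneNP.Theorems
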